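import Summits.NavierStokesRegularity.FunctionalMining.TopEigCutoffRamp
import Mathlib.Analysis.SpecialFunctions.Pow.Deriv
import HarnessLib

/-!
# FunctionalMining — the cut-off power weight `H_δ(s) = G_δ(s) · s^{q−2}` (tool for L-λ(η), `q > 2`)

Search for candidate a priori estimates; no regularity claim. Cell `pub-nsfunc`, prove seat (gen 26).
One-variable bookkeeping for Proposition L-λ(η) at a general exponent `q ≥ 2` on the top-gap class
(node `TopEigGapCoercivePos q η`): the weight `H_δ(s) := G_δ(s) s^{q−2}` (`G_δ = cutRamp δ` of
`TopEigCutoffRamp`) replaces `λ₁^{q−1}` in `M_q = λ₁^{q−1} e₁ ⊗ e₁`, vanishes on `(−∞, δ]`, and for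
`s > 0`, `q ≥ 2`:
`0 ≤ H_δ(s) ≤ s^{q−1}`, `s^{q−1} − H_δ(s) ≤ 2δ s^{q−2}`, `H_δ'(s) = g_δ(s)s^{q−2} + (q−2)G_δ(s)s^{q−3}`
with `0 ≤ H_δ' ≤ (q−1) s^{q−2}`, and `H_δ(s)² ≤ s^{q−1} H_δ(s)`, `H_δ'(s)² ≤ (q−1)s^{q−2} H_δ'(s)`.

[ours; folklore calculus]
-/

noncomputable section

open Set
open scoped ContDiff

namespace Summit.NavierStokesRegularity.FunctionalMining

namespace TopEig

/-- The cut-off power weight `H_δ(s) = G_δ(s) · s^{q−2}`. [folklore] -/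
def cutPow (δ q s : ℝ) : ℝ := cutRamp δ s * s ^ (q - 2)

/-- Its derivative profile `H_δ'(s) = g_δ(s) s^{q−2} + (q−2) G_δ(s) s^{q−3}` (valid for `s > 0`).
[folklore] -/
def cutPowDeriv (δ q s : ℝ) : ℝ :=
  cutStep δ s * s ^ (q - 2) + (q - 2) * cutRamp δ s * s ^ (q - 3)

/-- `H_δ' ` is the derivative of `H_δ` at every `s > 0`. [folklore] -/
theorem hasDerivAt_cutPow (δ q : ℝ) {s : ℝ} (hs : 0 < s) :
    HasDerivAt (cutPow δ q) (cutPowDeriv δ q s) s := by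
  have h1 := hasDerivAt_cutRamp δ s
  have h2 : HasDerivAt (fun x : ℝ => x ^ (q - 2)) ((q - 2) * s ^ (q - 2 - 1)) s :=
    Real.hasDerivAt_rpow_const (Or.inl hs.ne')
  have h := h1.mul h2
  have e : cutStep δ s * s ^ (q - 2) + cutRamp δ s * ((q - 2) * s ^ (q - 2 - 1)) = cutPowDeriv δ q s := by
    rw [cutPowDeriv, show q - 2 - 1 = q - 3 by ring]; ring
  rw [e] at h
  exact h

/-- `H_δ(s) = 0` for `s ≤ δ` (`δ > 0`). [folklore] -/
theorem cutPow_of_le {δ q s : ℝ} (hδ : 0 < δ) (hs : s ≤ δ) : cutPow δ q s = 0 := by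
  rw [cutPow, cutRamp_of_le hδ hs, zero_mul]

/-- `0 ≤ H_δ(s)` for `0 ≤ s`. [folklore] -/
theorem cutPow_nonneg {δ s : ℝ} (q : ℝ) (hs : 0 ≤ s) : 0 ≤ cutPow δ q s :=
  mul_nonneg (cutRamp_nonneg hs) (Real.rpow_nonneg hs _)

/-- `H_δ(s) ≤ s^{q−1}` for `s > 0`. [folklore] -/
theorem cutPow_le {δ s : ℝ} (q : ℝ) (hs : 0 < s) : cutPow δ q s ≤ s ^ (q - 1) := by
  rw [cutPow, show q - 1 = 1 + (q - 2) by ring, Real.rpow_add hs, Real.rpow_one]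
  exact mul_le_mul_of_nonneg_right (cutRamp_le_self hs.le) (Real.rpow_nonneg hs.le _)

/-- `s^{q−1} − H_δ(s) ≤ 2δ s^{q−2}` for `s > 0` (`δ > 0`). [folklore] -/
theorem rpow_sub_cutPow_le {δ s : ℝ} (q : ℝ) (hδ : 0 < δ) (hs : 0 < s) :
    s ^ (q - 1) - cutPow δ q s ≤ 2 * δ * s ^ (q - 2) := by
  rw [cutPow, show q - 1 = 1 + (q - 2) by ring, Real.rpow_add hs, Real.rpow_one, ← sub_mul]
  exact mul_le_mul_of_nonneg_right (self_sub_cutRamp_le hδ hs.le) (Real.rpow_nonneg hs.le _)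

/-- `0 ≤ s^{q−1} − H_δ(s)` for `s > 0`. [folklore] -/
theorem rpow_sub_cutPow_nonneg {δ s : ℝ} (q : ℝ) (hs : 0 < s) : 0 ≤ s ^ (q - 1) - cutPow δ q s :=
  sub_nonneg.2 (cutPow_le q hs)

/-- `0 ≤ H_δ'(s)` for `s > 0`, `q ≥ 2`. [folklore] -/
theorem cutPowDeriv_nonneg {δ q s : ℝ} (hq : 2 ≤ q) (hs : 0 < s) : 0 ≤ cutPowDeriv δ q s := by
  unfold cutPowDeriv
  have h1 := cutStep_nonneg δ s
  have h2 := cutRamp_nonneg (δ := δ) hs.le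
  have h3 : 0 ≤ s ^ (q - 2) := Real.rpow_nonneg hs.le _
  have h4 : 0 ≤ s ^ (q - 3) := Real.rpow_nonneg hs.le _
  have h5 : 0 ≤ q - 2 := by linarith
  positivity

/-- `H_δ'(s) ≤ (q−1) s^{q−2}` for `s > 0`, `q ≥ 2` (`g ≤ 1`, `G(s) ≤ s`). [folklore] -/
theorem cutPowDeriv_le {δ q s : ℝ} (hq : 2 ≤ q) (hs : 0 < s) :
    cutPowDeriv δ q s ≤ (q - 1) * s ^ (q - 2) := by
  unfold cutPowDeriv
  have h3 : 0 ≤ s ^ (q - 2) := Real.rpow_nonneg hs.le _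
  have h4 : 0 ≤ s ^ (q - 3) := Real.rpow_nonneg hs.le _
  have h1 : cutStep δ s * s ^ (q - 2) ≤ s ^ (q - 2) := by
    have := cutStep_le_one δ s; nlinarith
  have h2 : (q - 2) * cutRamp δ s * s ^ (q - 3) ≤ (q - 2) * s ^ (q - 2) := by
    have hG := cutRamp_le_self (δ := δ) hs.le
    have e : s * s ^ (q - 3) = s ^ (q - 2) := by
      rw [show q - 2 = 1 + (q - 3) by ring, Real.rpow_add hs, Real.rpow_one]
    have : (q - 2) * cutRamp δ s * s ^ (q - 3) ≤ (q - 2) * s * s ^ (q - 3) :=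
      mul_le_mul_of_nonneg_right (mul_le_mul_of_nonneg_left hG (by linarith)) h4
    rw [mul_assoc (q - 2) s, e] at this
    exact this
  linarith

/-- `H_δ(s)² ≤ s^{q−1} · H_δ(s)` for `s > 0` (from `0 ≤ H_δ ≤ s^{q−1}`). [folklore] -/
theorem cutPow_sq_le {δ s : ℝ} (q : ℝ) (hs : 0 < s) : cutPow δ q s ^ 2 ≤ s ^ (q - 1) * cutPow δ q s := by
  have h0 := cutPow_nonneg (δ := δ) q hs.le
  have h1 := cutPow_le (δ := δ) q hs
  nlinarith

/-- `H_δ'(s)² ≤ (q−1) s^{q−2} · H_δ'(s)` for `s > 0`, `q ≥ 2`. [folklore] -/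
theorem cutPowDeriv_sq_le {δ q s : ℝ} (hq : 2 ≤ q) (hs : 0 < s) :
    cutPowDeriv δ q s ^ 2 ≤ (q - 1) * s ^ (q - 2) * cutPowDeriv δ q s := by
  have h0 := cutPowDeriv_nonneg (δ := δ) hq hs
  have h1 := cutPowDeriv_le (δ := δ) hq hs
  nlinarith

/-- `H_δ(s) = G_δ(s) · s^{q−2}` rearranged: `H_δ(s) · s = G_δ(s) · s^{q−1}` (`s > 0`). [folklore] -/
theorem cutPow_mul_self {δ s : ℝ} (q : ℝ) (hs : 0 < s) : cutPow δ q s * s = cutRamp δ s * s ^ (q - 1) := by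
  rw [cutPow, show q - 1 = (q - 2) + 1 by ring, Real.rpow_add hs, Real.rpow_one]
  ring

/-- `H_δ(s)/s ≤ s^{q−2}`-type bound without division: `H_δ(s)² ≤ s · s^{q−2} · H_δ(s)` (`s > 0`).
[folklore] -/
theorem cutPow_sq_le' {δ s : ℝ} (q : ℝ) (hs : 0 < s) :
    cutPow δ q s ^ 2 ≤ s * s ^ (q - 2) * cutPow δ q s := by
  have h := cutPow_sq_le (δ := δ) q hs
  rw [show q - 1 = 1 + (q - 2) by ring, Real.rpow_add hs, Real.rpow_one] at h
  exact h

end TopEig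

end Summit.NavierStokesRegularity.FunctionalMining

end
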